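import Summits.Langlands.Langlands.Statement
import Literature.NumberTheory.EllipticCurves.FramedTateGaloisRep
import Literature.NumberTheory.Automorphic.GLnAdelicStructureProofs
import HarnessLib

/-!
# `QuinticEllipticGaloisToAutomorphic_onpath` — F4 on-path lemma (forward generator G4, generation 6)

`Langlands → EllipticGaloisToAutomorphicTR d` for every degree `d` (in particular the rung `d = 5`):
the summit's clause (B) at rank `2` over the totally real field `K`, applied to the framed dual Tate
module `ρ_{E,ℓ}^∨ = (E ⊗ K).framedTateGaloisRepDual ℓ` (`Literature/NumberTheory/EllipticCurves/FramedTateGaloisRep`)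
of an integral model `E / 𝓞 K` with elliptic generic fibre, for the reciprocity datum the summit provides.
`IsGeometricFramed Rec ρ` is assembled from the tree theorem
`WeierstrassCurve.eventually_isUnramifiedAt_framedTateGaloisRepDual` and the rung's de Rham hypothesis
(stated against the PINNED Fontaine datum, which is `Rec.pst` by `rfl`); `Corresponds` contains the a.e.
Satake–Frobenius clause in Buzzard–Gee's normalisation, i.e. the rung's conclusion with shift `m = 1`.
No `sorry`.
-/

noncomputable section

set_option linter.dupNamespace false

open scoped MatrixGroups Matrix NumberField Classical Polynomial
open Filter IsDedekindDomain Field Polynomial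
open Literature.NumberTheory.Automorphic Literature.NumberTheory.GaloisRepresentations
open Literature.NumberTheory.PAdicHodge
open Summit.Langlands

namespace Summit.Langlands.Langlands.Cruxes.ReciprocityUpToIrreducibility.QuinticEllipticGaloisToAutomorphic

/-- **The RUNG FAMILY, dial = degree `d` of the totally real base field** (clause (B) of the summit at
`n = 2` on the elliptic sector, Galois-side and archimedean-free exactly as the summit's `Corresponds`):
for every totally real number field `K` of degree `d`, every integral Weierstrass model `E / 𝓞 K` whose
generic fibre `E ⊗ K` is an elliptic curve, every prime `ℓ` and `ι : ℚ̄_ℓ ≃+* ℂ`: if the framed dual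
Tate module `ρ := ρ_{E,ℓ}^∨ : Γ_K → GL₂(ℚ̄_ℓ)` is irreducible and de Rham at the places above `ℓ`
(for the pinned Fontaine datum), then there are a cuspidal automorphic representation `π` of
`GL₂(𝔸_K)` and a shift `m : ℕ` such that at all but finitely many finite places `v`, `π_v` is
unramified with Satake parameter `α`, `ρ` is unramified at `v`, and every arithmetic Frobenius at `v`
has characteristic polynomial `∏_{a ∈ α} (X - ι⁻¹((q_v^{(m-1)/2} a)⁻¹))` on `ρ`
(`arithFrobPolyOfSatake ι q_v m α`; `m = 1` is Buzzard–Gee's L-normalisation used by the summit,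
`m = 2` the C-normalisation in which the weight-`2` Hilbert newform of `E` appears). -/
def EllipticGaloisToAutomorphicTR (d : ℕ) : Prop :=
  ∀ (K : Type) [Field K] [NumberField K] [NumberField.IsTotallyReal K], Module.finrank ℚ K = d →
    ∀ (E : WeierstrassCurve (𝓞 K)) [(E.baseChange K).IsElliptic] (ℓ : ℕ) [Fact ℓ.Prime]
      (ι : PadicAlgCl ℓ ≃+* ℂ),
      ((E.baseChange K).framedTateGaloisRepDual ℓ).toGaloisRep.IsIrreducible →
      (∀ (v : HeightOneSpectrum (𝓞 K)) (hv : ((ℓ : ℕ) : 𝓞 K) ∈ v.asIdeal),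
          (fontainePstAdicCompletion v ℓ hv).IsDeRhamFramed
            (((E.baseChange K).framedTateGaloisRepDual ℓ).toLocal v)) →
      ∃ (hK : isCompact_glFiniteIntegralLevel 2 K) (π : CuspidalAutomorphicRepData 2 K hK) (m : ℕ),
        ∀ᶠ v : HeightOneSpectrum (𝓞 K) in Filter.cofinite, ∃ α : Multiset ℂ,
          π.1.HasSatakeParamAt v α ∧
          ((E.baseChange K).framedTateGaloisRepDual ℓ).IsUnramifiedAt v ∧
          ((E.baseChange K).framedTateGaloisRepDual ℓ).HasFrobCharpolyAt v
            (arithFrobPolyOfSatake ι v.residueCard m α)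

/-- **THE RUNG** (the filed statement): the family at `d = 5` — clause (B) for the Tate modules of
elliptic curves over totally real QUINTIC fields. -/
def QuinticEllipticGaloisToAutomorphic : Prop := EllipticGaloisToAutomorphicTR 5

/-- **Dial monotonicity in the summit direction**: the summit gives every rung of the family
(restriction of clause (B) at `n = 2` to `ρ_{E,ℓ}^∨`, shift `m = 1`). -/
theorem ellipticGaloisToAutomorphicTR_of_langlands (d : ℕ) (hL : _root_.Langlands) :
    EllipticGaloisToAutomorphicTR d := by
  intro K _ _ _ _hd E _ ℓ _ ι hirr hdR
  obtain ⟨⟨Rec⟩, hall⟩ := hL K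
  have hcpt : isCompact_glFiniteIntegralLevel 2 K := isCompact_glFiniteIntegralLevel_holds 2 K
  have hB : GaloisToAutomorphic 2 Rec hcpt := (hall Rec 2 two_pos hcpt).2
  have hgeo : IsGeometricFramed Rec ((E.baseChange K).framedTateGaloisRepDual ℓ) :=
    ⟨(E.baseChange K).eventually_isUnramifiedAt_framedTateGaloisRepDual ℓ, fun v hv => hdR v hv⟩
  obtain ⟨π, -, hcorr⟩ := hB ℓ ι _ hirr hgeo
  refine ⟨hcpt, π, 1, ?_⟩
  filter_upwards [hcorr.1] with v hv
  exact hv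

/-- **F4 on-path lemma for the rung**: `Langlands → QuinticEllipticGaloisToAutomorphic`. -/
@[aesop safe apply]
theorem QuinticEllipticGaloisToAutomorphic_of_Langlands (hL : _root_.Langlands) :
    QuinticEllipticGaloisToAutomorphic :=
  ellipticGaloisToAutomorphicTR_of_langlands 5 hL

end Summit.Langlands.Langlands.Cruxes.ReciprocityUpToIrreducibility.QuinticEllipticGaloisToAutomorphic

end
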